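import Summits.AtomisticToContinuum.Crystallization.Theorems.OverbindingBudgetEdgeRelaxationStatements

/-!
# OverbindingBudget — «EdgeRelaxation»: LIOUBᵘ reduced to its extremal class and cut energetically (decomp-a2c lens-4, generation 26; proofs)

Helper file (`--supports stmt-AtomisticToContinuum-31280`; statements and reading in `…OverbindingBudgetEdgeRelaxationStatements`).
Proved here, complete and over landed Theorems files only:

* §E `liouBallsU_of_recurrent : 0 ≤ T₀ → RecurrentLiouBallsU T₀ D → CleanLiouvilleBallsU T₀ D` — THE LENS-4 MOVE on LIOUBᵘ.  A would-be
  counterexample `Y` (a globally `RT a T₀`-clean thin-cored `μ`-ground state with, for some `t, L`, NO `t`-clean `L`-ball at any admissible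
  scale) has `t`-robust violators `L`-densely at EVERY admissible scale (`violatorsL_of_violators`); the HULL FAMILY `Hull` of rooted
  `δ`-separated `9/10`-covering `μ`-ground states at `e` with loosened thin cores (host `b`), global `RT a T₀`-cleanness and those violators
  contains `Y − y₀`, is re-rooting closed (translation covariance of every clause) and closed under local limits (`solid_of_limit`,
  `muGSCLimitClosed`, `thinCoresL_of_limit`, `rtAbove_of_limit_spacing` at the constant spacing `a` + `rt_of_rtAbove`, `violatorsL_of_limit`
  scale by scale); the hull engine `minimalRecurrent` (generation 21; Birkhoff) gives a UNIFORMLY RECURRENT member `Z`, which the recurrent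
  law makes `t/2`-clean on an `L`-ball at some admissible `a'` — where `Z` has a `t`-robust violator at that very `a'`.
* §F `recurrentLiouBallsU_of_edgeRelaxationLaw : EdgeRelaxationLaw T₀ D → RecurrentLiouBallsU T₀ D` — THE ENERGETIC CUT.  If the recurrent
  law failed for `Y`, the edge-relaxation law gives `κ > 0` and cofinal cube chunks `F = Y ∩ Q_ℓ(c)` with `E(#F) + κℓ³ ≤ U(F)` (own interaction
  energy); but `e ≤ E(N)/N` gives `e·#F ≤ E(#F)`, the REMOVAL TEST of `μ`-stability (`stub_removalUpperBound`, Sütő) gives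
  `U(F) + I(F, Y∖F) ≤ e·#F`, and the cross field is small, `|I(F, Y∖F)| ≤ (κ/2) ℓ³` for `ℓ ≥ ℓ₀` (`stub_crossTermSmall`): `κ ℓ³ ≤ κ ℓ³/2`.
  This is where the energy `e` is USED (critic rows 348/361: «must use e, not force balance alone»).
* §G the cones: `liouBallsU_of_edgeRelaxationLaw`, `rdef_of_grossU_recurrentLiou_coherent`, `rdef_of_grossU_edgeRelaxation_coherent :
  0 < T₀ → GrossCleanBallsU T₀ 10 → EdgeRelaxationLaw T₀ 10 → CleanlessExcessT → CoherentResidual 10 → RobustDefectLimitWindows`.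
* §H readable pin of the edge-relaxation law.

PIECES / TAGS (decomp-a2c bookkeeping; card NODE-g26-EdgeRelaxation.md).  LIOUBᵘ ⟸ [R] (§E, PROVED) ∧ `RecurrentLiouBallsU` [KERNEL-WEAKER,
`recurrentLiouBallsU_of_liouBallsU`];  `RecurrentLiouBallsU` ⟸ [B] (§F, PROVED bookkeeping) ∧ `EdgeRelaxationLaw` [RELAX: `e`-free, `μ`-free,
STRONGER-in-kind (variational), XL · INSTRUMENTABLE (I-EDGE: energies of the cheapest PERIODIC strained clean textures per type vs the Barlow
optimum) · split beneath by the scale-free typing (`…EdgeRelaxationTyping.edgeRelaxationLaw_of_typed`)].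
-/

noncomputable section

namespace Summit.AtomisticToContinuum.Crystallization.Theorems.OverbindingBudgetEdgeRelaxation

open Filter Metric Set Topology
open scoped BigOperators
open Literature.MathematicalPhysics.StatisticalMechanics
open Summit.AtomisticToContinuum.Crystallization.Theses.OverbindingBudget (RobustDefectLimitWindows)
open Summit.AtomisticToContinuum.Crystallization.Theorems.OverbindingBudgetViolatorDensityFloor (RT)
open Summit.AtomisticToContinuum.Crystallization.Theorems.OverbindingBudgetGradedBareness (CleanlessExcessT)
open Summit.AtomisticToContinuum.Crystallization.Theorems.OverbindingBudgetCoherentCut (CoherentResidual)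
open Summit.AtomisticToContinuum.Crystallization.Theorems.OverbindingBudgetCubeBookkeeping (stub_removalUpperBound)
open Summit.AtomisticToContinuum.Crystallization.Theorems.OverbindingBudgetCubeChargeLaw (stub_crossTermSmall)
open Summit.AtomisticToContinuum.Crystallization.Theorems.OverbindingBudgetHullEngine (minimalRecurrent)
open Summit.AtomisticToContinuum.Crystallization.Theorems.OverbindingBudgetRecurrentSealStatements (UniformlyRecurrent sep_translate
  solid_translate translate_translate)
open Summit.AtomisticToContinuum.Crystallization.Theorems.OverbindingBudgetRecurrentSealClosure (solid_of_limit)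
open Summit.AtomisticToContinuum.Crystallization.Theorems.OverbindingBudgetRecurrentDustStatements (ThinCoresL ViolatorsL rt_mono
  thinCoresL_translate rt_translate violatorsL_translate violatorsL_of_violators)
open Summit.AtomisticToContinuum.Crystallization.Theorems.OverbindingBudgetRecurrentDustClosure (thinCoresL_of_limit violatorsL_of_limit)
open Summit.AtomisticToContinuum.Crystallization.Theorems.OverbindingBudgetRegularityCutLimit (isMuGSC_translate)
open Summit.AtomisticToContinuum.Crystallization.Theorems.OverbindingBudgetMuGSCLimit (muGSCLimitClosed)
open Summit.AtomisticToContinuum.Crystallization.Theorems.OverbindingBudgetUniformCutStatements (GrossCleanBallsU MuCleanBallsU)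
open Summit.AtomisticToContinuum.Crystallization.Theorems.OverbindingBudgetUniformCutLimit (rtAbove_of_limit_spacing rt_of_rtAbove)
open Summit.AtomisticToContinuum.Crystallization.Theorems.OverbindingBudgetUniformCutDensity (CleanLiouvilleBallsU mcbU_of_grossU_liouBallsU
  rdef_of_grossU_liouBallsU_coherent)
open Summit.AtomisticToContinuum.Crystallization.Theorems.OverbindingBudgetEdgeRelaxationStatements

/-! ## §E  LIOUBᵘ reduces to its extremal class -/

/-- The hull family of a would-be counterexample to LIOUBᵘ at data `(δ, e, b, D, a, T₀, t, L)`: rooted, `δ`-separated, `9/10`-covering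
`μ`-ground states at `e` with loosened thin cores (host spacing `b`, radius `D`), passing `RT a T₀` everywhere, with `t`-robust violators
`L`-densely at every admissible scale. -/
def Hull (δ e b D a T₀ t L : ℝ) : Set (Set (EuclideanSpace ℝ (Fin 3))) :=
  {Z | (0 : EuclideanSpace ℝ (Fin 3)) ∈ Z ∧ (∀ p ∈ Z, ∀ q ∈ Z, p ≠ q → δ ≤ dist p q) ∧
    (∀ z : EuclideanSpace ℝ (Fin 3), ∃ w ∈ Z, dist z w ≤ 9 / 10) ∧ IsMuGSC lennardJones e Z ∧ ThinCoresL b D Z ∧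
    (∀ y ∈ Z, RT a T₀ Z y) ∧ ∀ a' : ℝ, 47 / 50 ≤ a' → a' ≤ 1 → ViolatorsL a' t L Z}

/-- Membership in the hull family, unfolded. [this file] -/
theorem mem_hull {δ e b D a T₀ t L : ℝ} {Z : Set (EuclideanSpace ℝ (Fin 3))} :
    Z ∈ Hull δ e b D a T₀ t L ↔
      ((0 : EuclideanSpace ℝ (Fin 3)) ∈ Z ∧ (∀ p ∈ Z, ∀ q ∈ Z, p ≠ q → δ ≤ dist p q) ∧
        (∀ z : EuclideanSpace ℝ (Fin 3), ∃ w ∈ Z, dist z w ≤ 9 / 10) ∧ IsMuGSC lennardJones e Z ∧ ThinCoresL b D Z ∧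
        (∀ y ∈ Z, RT a T₀ Z y) ∧ ∀ a' : ℝ, 47 / 50 ≤ a' → a' ≤ 1 → ViolatorsL a' t L Z) :=
  Iff.rfl

/-- Re-rooting preserves global cleanness. [folklore] -/
theorem clean_translate {a T₀ : ℝ} {Y : Set (EuclideanSpace ℝ (Fin 3))} (v : EuclideanSpace ℝ (Fin 3)) (h : ∀ y ∈ Y, RT a T₀ Y y) :
    ∀ y ∈ (fun p => p - v) '' Y, RT a T₀ ((fun p => p - v) '' Y) y := by
  rintro _ ⟨p, hp, rfl⟩
  exact rt_translate v (h p hp)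

/-- **LIOUBᵘ reduces to its extremal class**: `RecurrentLiouBallsU T₀ D → CleanLiouvilleBallsU T₀ D` for `0 ≤ T₀` (proof in the module
docstring: hull family, landed limit closures, hull engine `minimalRecurrent`). [this file] -/
theorem liouBallsU_of_recurrent {T₀ D : ℝ} (hT₀ : 0 ≤ T₀) (h : RecurrentLiouBallsU T₀ D) : CleanLiouvilleBallsU T₀ D := by
  classical
  intro e hT hlb Y hUD hcov hμ b hb1 hb2 hthin a ha1 ha2 hclean t ht L
  by_contra hno
  push Not at hno
  obtain ⟨δ, hδ, hsepY⟩ := id hUD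
  have hViol : ∀ a' : ℝ, 47 / 50 ≤ a' → a' ≤ 1 → ViolatorsL a' t L Y := fun a' h1 h2 =>
    violatorsL_of_violators hUD (hno a' h1 h2)
  -- the hull family is non-empty, rooted, separated, re-rooting closed and limit closed
  obtain ⟨y₀, hy₀, -⟩ := hcov 0
  have hne : (Hull δ e b D a T₀ t L).Nonempty :=
    ⟨(fun p => p - y₀) '' Y, mem_hull.2 ⟨⟨y₀, hy₀, sub_self y₀⟩, sep_translate y₀ hsepY, solid_translate y₀ hcov,
      isMuGSC_translate hUD hμ y₀, thinCoresL_translate y₀ hthin, clean_translate y₀ hclean,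
      fun a' h1 h2 => violatorsL_translate y₀ (hViol a' h1 h2)⟩⟩
  have hsepC : ∀ Z ∈ Hull δ e b D a T₀ t L, ∀ p ∈ Z, ∀ q ∈ Z, p ≠ q → δ ≤ dist p q := fun Z hZ => (mem_hull.1 hZ).2.1
  have h0C : ∀ Z ∈ Hull δ e b D a T₀ t L, (0 : EuclideanSpace ℝ (Fin 3)) ∈ Z := fun Z hZ => (mem_hull.1 hZ).1
  have hrootC : ∀ Z ∈ Hull δ e b D a T₀ t L, ∀ z ∈ Z, (fun p => p - z) '' Z ∈ Hull δ e b D a T₀ t L := by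
    intro Z hZ z hz
    obtain ⟨-, h2, h3, h4, h5, h6, h7⟩ := mem_hull.1 hZ
    exact mem_hull.2 ⟨⟨z, hz, sub_self z⟩, sep_translate z h2, solid_translate z h3, isMuGSC_translate ⟨δ, hδ, h2⟩ h4 z,
      thinCoresL_translate z h5, clean_translate z h6, fun a' h1' h2' => violatorsL_translate z (h7 a' h1' h2')⟩
  have hclosedC : ∀ Zs : ℕ → Set (EuclideanSpace ℝ (Fin 3)), (∀ k, Zs k ∈ Hull δ e b D a T₀ t L) →
      ∀ Z : Set (EuclideanSpace ℝ (Fin 3)), (0 : EuclideanSpace ℝ (Fin 3)) ∈ Z → (∀ p ∈ Z, ∀ q ∈ Z, p ≠ q → δ ≤ dist p q) →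
      (∀ R ε : ℝ, 0 < ε → ∀ᶠ k in atTop, Match ε R 0 (Zs k) Z) → Z ∈ Hull δ e b D a T₀ t L := by
    intro Zs hZs Z hZ0 hZsep hconv
    have hk := fun k => mem_hull.1 (hZs k)
    have hρ : Tendsto (fun k : ℕ => ((k : ℕ) : ℝ)) atTop atTop := tendsto_natCast_atTop_atTop
    have has : Tendsto (fun _ : ℕ => a) atTop (𝓝 a) := tendsto_const_nhds
    have hcleanZ : ∀ y' ∈ Z, ∀ s : ℝ, T₀ < s → RT a s Z y' :=
      rtAbove_of_limit_spacing hδ ha1 ha2 hT₀ (fun k => (hk k).2.1) hZsep hconv hρ has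
        fun k y hy _ => (hk k).2.2.2.2.2.1 y hy
    refine mem_hull.2 ⟨hZ0, hZsep, solid_of_limit hδ hZsep hconv fun k => (hk k).2.2.1,
      muGSCLimitClosed e δ hδ Zs Z (fun k => (hk k).2.1) (fun k => (hk k).2.2.2.1) hZsep hconv,
      thinCoresL_of_limit hδ hb1 hb2 (fun k => (hk k).2.1) hZsep hconv fun k => (hk k).2.2.2.2.1,
      fun y' hy' => rt_of_rtAbove ⟨δ, hδ, hZsep⟩ (hcleanZ y' hy'),
      fun a' h1 h2 => violatorsL_of_limit hδ h1 h2 (fun k => (hk k).2.1) hZsep hconv fun k => (hk k).2.2.2.2.2.2 a' h1 h2⟩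
  -- a uniformly recurrent member, charged by the recurrent law at margin `t/2`
  obtain ⟨Z, hZC, hrec⟩ := minimalRecurrent δ hδ _ hne hsepC h0C hrootC hclosedC
  obtain ⟨hZ0, hZsep, hZsolid, hZμ, hZthin, hZclean, hZviol⟩ := mem_hull.1 hZC
  have hrec' : UniformlyRecurrent Z := fun R ε hε => hrec R ε hε
  obtain ⟨a', ha1', ha2', q₀, hq₀, hall⟩ :=
    h e hT hlb Z ⟨δ, hδ, hZsep⟩ hZ0 hrec' hZsolid hZμ b hb1 hb2 hZthin a ha1 ha2 hZclean (t / 2) (by linarith) L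
  obtain ⟨y, hy, hyd, hn⟩ := hZviol a' ha1' ha2' q₀ hq₀
  exact hn (t / 2) (by linarith) (by linarith) (hall y hy hyd)

/-! ## §F  The energetic cut: the edge-relaxation law gives the recurrent Liouville law -/

/-- `E(0) ≥ 0` (indeed `= 0`: no pairs). [folklore] -/
theorem groundStateEnergy_zero_nonneg : 0 ≤ groundStateEnergy lennardJones 3 0 := by
  unfold groundStateEnergy
  exact Real.iInf_nonneg fun x => le_of_eq (interactionEnergy_of_subsingleton (V := lennardJones) x.1).symm

/-- `e ≤ E(N)/N` for all `N > 0` gives `e · N ≤ E(N)` for all `N`. [folklore] -/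
theorem mul_card_le_groundStateEnergy {e : ℝ} (hlb : ∀ N : ℕ, 0 < N → e ≤ groundStateEnergy lennardJones 3 N / N) (N : ℕ) :
    e * (N : ℝ) ≤ groundStateEnergy lennardJones 3 N := by
  rcases Nat.eq_zero_or_pos N with h0 | hpos
  · subst h0
    simpa using groundStateEnergy_zero_nonneg
  · have h := hlb N hpos
    rwa [le_div_iff₀ (by exact_mod_cast hpos)] at h

/-- **The energetic cut**: `EdgeRelaxationLaw T₀ D → RecurrentLiouBallsU T₀ D` (removal test of `μ`-stability + small cross field +
`e ≤ E(N)/N` against strained cubes; proof in the module docstring). [this file] -/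
theorem recurrentLiouBallsU_of_edgeRelaxationLaw {T₀ D : ℝ} (h : EdgeRelaxationLaw T₀ D) : RecurrentLiouBallsU T₀ D := by
  classical
  intro e hT hlb Y hUD h0 hrec hcov hμ b hb1 hb2 hthin a ha1 ha2 hclean t ht L
  by_contra hno
  push Not at hno
  have hViol : ∀ a' : ℝ, 47 / 50 ≤ a' → a' ≤ 1 → ViolatorsL a' t L Y := fun a' h1 h2 =>
    violatorsL_of_violators hUD (hno a' h1 h2)
  obtain ⟨κ, hκ, hS⟩ := h Y ⟨hUD, h0, hrec, hcov, ⟨b, hb1, hb2, hthin⟩, ⟨a, ha1, ha2, hclean⟩⟩ t ht L hViol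
  obtain ⟨ℓ₀, hℓ₀⟩ := stub_crossTermSmall Y hUD (κ / 2) (by linarith)
  obtain ⟨ℓ, hℓ, c, F, hF, hE⟩ := hS (max ℓ₀ 1)
  have hℓ1 : 1 ≤ ℓ := (le_max_right _ _).trans hℓ
  have hFY : (↑F : Set (EuclideanSpace ℝ (Fin 3))) ⊆ Y := by
    rw [hF]; exact Set.inter_subset_left
  have hX := hℓ₀ ℓ c ((le_max_left _ _).trans hℓ) F hF
  have hR := stub_removalUpperBound e Y hUD hμ F hFY
  have hG := mul_card_le_groundStateEnergy hlb F.card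
  have hpos : 0 < κ * ℓ ^ 3 := by positivity
  rw [abs_le] at hX
  linarith [hX.1, hX.2]

/-! ## §G  The cones -/

/-- `EdgeRelaxationLaw T₀ D → CleanLiouvilleBallsU T₀ D` (`0 ≤ T₀`). [this file] -/
theorem liouBallsU_of_edgeRelaxationLaw {T₀ D : ℝ} (hT₀ : 0 ≤ T₀) (h : EdgeRelaxationLaw T₀ D) : CleanLiouvilleBallsU T₀ D :=
  liouBallsU_of_recurrent hT₀ (recurrentLiouBallsU_of_edgeRelaxationLaw h)

/-- The uniform cut from the recurrent Liouville law: `GrossCleanBallsU T₀ D → RecurrentLiouBallsU T₀ D → MuCleanBallsU D` (`0 < T₀`). [this file] -/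
theorem mcbU_of_grossU_recurrentLiou {T₀ D : ℝ} (hT : 0 < T₀) (hG : GrossCleanBallsU T₀ D) (hL : RecurrentLiouBallsU T₀ D) :
    MuCleanBallsU D :=
  mcbU_of_grossU_liouBallsU hT hG (liouBallsU_of_recurrent hT.le hL)

/-- **Cone with the recurrent Liouville law**: `GrossCleanBallsU T₀ 10 → RecurrentLiouBallsU T₀ 10 → CleanlessExcessT → CoherentResidual 10 →
RobustDefectLimitWindows` (`0 < T₀`). [this file] -/
theorem rdef_of_grossU_recurrentLiou_coherent {T₀ : ℝ} (hT : 0 < T₀) (hG : GrossCleanBallsU T₀ 10) (hL : RecurrentLiouBallsU T₀ 10)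
    (hCE : CleanlessExcessT) (hR : CoherentResidual 10) : RobustDefectLimitWindows :=
  rdef_of_grossU_liouBallsU_coherent hT hG (liouBallsU_of_recurrent hT.le hL) hCE hR

/-- **Cone with the edge-relaxation law**: `GrossCleanBallsU T₀ 10 → EdgeRelaxationLaw T₀ 10 → CleanlessExcessT → CoherentResidual 10 →
RobustDefectLimitWindows` (`0 < T₀`) — the cone of record with its second law replaced by the `e`-free, `μ`-free variational law. [this file] -/
theorem rdef_of_grossU_edgeRelaxation_coherent {T₀ : ℝ} (hT : 0 < T₀) (hG : GrossCleanBallsU T₀ 10) (hE : EdgeRelaxationLaw T₀ 10)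
    (hCE : CleanlessExcessT) (hR : CoherentResidual 10) : RobustDefectLimitWindows :=
  rdef_of_grossU_recurrentLiou_coherent hT hG (recurrentLiouBallsU_of_edgeRelaxationLaw hE) hCE hR

/-- The cone at the record numerals `T₀ = 1/250`. [this file] -/
theorem rdef_of_grossU_edgeRelaxation_record (hG : GrossCleanBallsU (1 / 250) 10) (hE : EdgeRelaxationLaw (1 / 250) 10)
    (hCE : CleanlessExcessT) (hR : CoherentResidual 10) : RobustDefectLimitWindows :=
  rdef_of_grossU_edgeRelaxation_coherent (T₀ := 1 / 250) (by norm_num) hG hE hCE hR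

/-! ## §H  Readable pin of the edge-relaxation law -/

/-- The edge-relaxation law with `CleanClass`, `ViolatorsL` and `StrainedCubes` unfolded (the currency predicates `UniformlyRecurrent`,
`ThinCoresL`, `RT` are kept by name; their expansions are pinned in `…RecurrentSealStatements`, `…UniformCutPins`). [this file] -/
theorem edgeRelaxationLaw_iff_readable {T₀ D : ℝ} :
    EdgeRelaxationLaw T₀ D ↔
      ∀ Y : Set (EuclideanSpace ℝ (Fin 3)),
        (UniformlyDiscrete Y ∧ (0 : EuclideanSpace ℝ (Fin 3)) ∈ Y ∧ UniformlyRecurrent Y ∧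
          (∀ z : EuclideanSpace ℝ (Fin 3), ∃ w ∈ Y, dist z w ≤ 9 / 10) ∧
          (∃ b : ℝ, 47 / 50 ≤ b ∧ b ≤ 1 ∧ ThinCoresL b D Y) ∧ ∃ a : ℝ, 47 / 50 ≤ a ∧ a ≤ 1 ∧ ∀ y ∈ Y, RT a T₀ Y y) →
        ∀ t : ℝ, 0 < t → ∀ L : ℝ,
          (∀ a' : ℝ, 47 / 50 ≤ a' → a' ≤ 1 → ∀ q ∈ Y, ∃ y ∈ Y, dist y q ≤ L ∧ ∀ s : ℝ, 0 < s → s < t → ¬ RT a' s Y y) →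
          ∃ κ : ℝ, 0 < κ ∧ ∀ ℓ₀ : ℝ, ∃ ℓ : ℝ, ℓ₀ ≤ ℓ ∧ ∃ c : EuclideanSpace ℝ (Fin 3), ∃ F : Finset (EuclideanSpace ℝ (Fin 3)),
            (↑F : Set (EuclideanSpace ℝ (Fin 3))) = Y ∩ {z | ∀ i : Fin 3, c i ≤ z i ∧ z i < c i + ℓ} ∧
              groundStateEnergy lennardJones 3 F.card + κ * ℓ ^ 3 ≤ 1 / 2 * ∑ y ∈ F, ∑ w ∈ F, lennardJones (dist y w) :=
  Iff.rfl

end Summit.AtomisticToContinuum.Crystallization.Theorems.OverbindingBudgetEdgeRelaxation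

end
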